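import Summits.CriticalPhenomena.PercolationContinuityZ3.Theorems.PercNearOneGluingNoHeavyQuantThreeRootGateCoupling
import HarnessLib

/-!
# QUANT lane R8, T-DEC: THE THREE-ROOT BLOCK-FAMILY IDENTITY with free weights (census-2 g71, TIED3-G71 §0.4)

builds on p205010 (kernel theorem, internal audit signed; external expert review pending)

Support file (`--supports stmt-CriticalPhenomena-4575`), QUANT lane seat prim-quant-census-2 (gen 71); memo
`run/shared/lean/prim/quant/prim-quant-census-2-g71/TIED3-G71.md` §0.4.  Pure algebra of `gate`/`lconv` (one theorem, standard axioms, no sorries);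
sequel of `…QuantThreeRootGateCoupling` (✓ p395425: `lconv3_gate_expand`, `lconv_lconv_swap`, `gate_eq_zero_of_top`).

`threeRootBlock_mixture`: for laws `ρᵢ` on `{0..Mᵢ}`, a common root gate `p`, an outer gate `a` and reals `s r wA wA2 wB wC wP` satisfying the
four ROOT-PATTERN EQUATIONS (probability of the patterns none / a given single / a given pair / all three under `(1−a)δ₀₀₀ + a·Bern(p)^⊗3`
versus under the mixture), the count law `gate_a(gate_p ρ₁ ∗ gate_p ρ₂ ∗ gate_p ρ₃)` equals, pointwise,
`wA·Ā + wA2·Ā2 + wB·gate_s(ρ₁∗ρ₂∗ρ₃) + wC·C̄ + wP·(gate_s ρ₁ ∗ gate_s ρ₂ ∗ gate_s ρ₃)` with the symmetrised families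
`Ā = (1/3)Σᵢ gate_r(ρ_j∗ρ_k)` (pair block, tree `i` ABSENT), `Ā2 = (1/3)Σᵢ gate_r ρ_j ∗ gate_r ρ_k` (two independent re-gated trees, tree `i` absent),
`C̄ = (1/3)Σᵢ gate_s ρᵢ ∗ gate_s(ρ_j∗ρ_k)`.  In use `s = ap`, `r = 3s/2`; the DEC consequences (every component a `GateStepN`-oracle instance when the
opened means are equal; explicit nonnegative weights for every `a ≤ min(1, 2/(3p))`) are in `…QuantThreeRootBlockFamily` / `…QuantThreeRootBlockRegimes`.

HONEST STATUS.  `GateStepN`, `FarTreeRow` remain OPEN; RATE class (log\*) and the honest sentence of `run/shared/lean/prim/quant/README.md` unchanged.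
[this work].  Nothing here is a published result.  The gluing rows served [cite: KozmaNitzan2024, Conjecture 3 (p. 15)]; product measure
[cite: Grimmett1999, §1.3 p. 10].
-/

noncomputable section

namespace Summit.CriticalPhenomena.PercolationContinuityZ3.Theorems

namespace Quant

open Finset

namespace LawDec

/-! ### The block-product family (census-2 g71, TIED3-G71 §0.4): A, A2, B, C, P components with free weights -/

/-- **THE THREE-ROOT BLOCK-FAMILY IDENTITY (free weights).**  Laws `ρᵢ` on `{0..Mᵢ}`, a common root gate `p`, an outer gate `a`, and
reals `s r wA wA2 wB wC wP` satisfying the four ROOT-PATTERN EQUATIONS (none / single / pair / triple):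
`hE0 … hE3`.  Then `gate_a(gate_p ρ₁ ∗ gate_p ρ₂ ∗ gate_p ρ₃) = wA·Ā + wA2·Ā2 + wB·gate_s(ρ₁∗ρ₂∗ρ₃) + wC·C̄ + wP·(gate_s ρ₁ ∗ gate_s ρ₂ ∗ gate_s ρ₃)`
pointwise, where `Ā = (1/3)Σᵢ gate_r(ρ_j∗ρ_k)` (pair block, tree `i` absent), `Ā2 = (1/3)Σᵢ gate_r ρ_j ∗ gate_r ρ_k` (two independent re-gated
trees, tree `i` absent), `C̄ = (1/3)Σᵢ gate_s ρᵢ ∗ gate_s(ρ_j∗ρ_k)`.  (In use `s = ap`, `r = 3s/2`.) [this work] -/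
theorem threeRootBlock_mixture (M₁ M₂ M₃ : ℕ) (ρ₁ ρ₂ ρ₃ : ℕ → ℝ) (p a s r wA wA2 wB wC wP : ℝ)
    (h₁M : ∀ h, M₁ < h → ρ₁ h = 0) (h₂M : ∀ h, M₂ < h → ρ₂ h = 0) (h₃M : ∀ h, M₃ < h → ρ₃ h = 0)
    (hE0 : 1 - a + a * (1 - p) ^ 3 = wA * (1 - r) + wA2 * (1 - r) ^ 2 + wB * (1 - s) + wC * (1 - s) ^ 2 + wP * (1 - s) ^ 3)
    (hE1 : a * p * (1 - p) ^ 2 = wA2 * (2 / 3) * r * (1 - r) + wC * s * (1 - s) / 3 + wP * s * (1 - s) ^ 2)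
    (hE2 : a * p ^ 2 * (1 - p) = wA * r / 3 + wA2 * r ^ 2 / 3 + wC * s * (1 - s) / 3 + wP * s ^ 2 * (1 - s))
    (hE3 : a * p ^ 3 = wB * s + wC * s ^ 2 + wP * s ^ 3) (h : ℕ) :
    gate (lconv (M₁ + M₂) M₃ (lconv M₁ M₂ (gate ρ₁ p) (gate ρ₂ p)) (gate ρ₃ p)) a h
      = wA * ((1 / 3) * (gate (lconv M₂ M₃ ρ₂ ρ₃) r h + gate (lconv M₁ M₃ ρ₁ ρ₃) r h + gate (lconv M₁ M₂ ρ₁ ρ₂) r h))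
        + wA2 * ((1 / 3) * (lconv M₂ M₃ (gate ρ₂ r) (gate ρ₃ r) h + lconv M₁ M₃ (gate ρ₁ r) (gate ρ₃ r) h
            + lconv M₁ M₂ (gate ρ₁ r) (gate ρ₂ r) h))
        + wB * gate (lconv (M₁ + M₂) M₃ (lconv M₁ M₂ ρ₁ ρ₂) ρ₃) s h
        + wC * ((1 / 3) * (lconv M₁ (M₂ + M₃) (gate ρ₁ s) (gate (lconv M₂ M₃ ρ₂ ρ₃) s) h
            + lconv M₂ (M₁ + M₃) (gate ρ₂ s) (gate (lconv M₁ M₃ ρ₁ ρ₃) s) h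
            + lconv (M₁ + M₂) M₃ (gate (lconv M₁ M₂ ρ₁ ρ₂) s) (gate ρ₃ s) h))
        + wP * lconv (M₁ + M₂) M₃ (lconv M₁ M₂ (gate ρ₁ s) (gate ρ₂ s)) (gate ρ₃ s) h := by
  have h₁₂M : ∀ k, M₁ + M₂ < k → lconv M₁ M₂ ρ₁ ρ₂ k = 0 := fun k hk => lconv_eq_zero _ _ _ _ k hk
  have h₁₃M : ∀ k, M₁ + M₃ < k → lconv M₁ M₃ ρ₁ ρ₃ k = 0 := fun k hk => lconv_eq_zero _ _ _ _ k hk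
  have h₂₃M : ∀ k, M₂ + M₃ < k → lconv M₂ M₃ ρ₂ ρ₃ k = 0 := fun k hk => lconv_eq_zero _ _ _ _ k hk
  rw [gate_apply _ a h, lconv3_gate_expand M₁ M₂ M₃ ρ₁ ρ₂ ρ₃ p p p h₁M h₂M h₃M h,
    lconv3_gate_expand M₁ M₂ M₃ ρ₁ ρ₂ ρ₃ s s s h₁M h₂M h₃M h,
    gate_apply (lconv M₂ M₃ ρ₂ ρ₃) r h, gate_apply (lconv M₁ M₃ ρ₁ ρ₃) r h, gate_apply (lconv M₁ M₂ ρ₁ ρ₂) r h,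
    -- A2 components
    lconv_gate_left M₂ M₃ ρ₂ _ r (gate_eq_zero_of_top M₃ ρ₃ r h₃M) h, lconv_gate_right M₂ M₃ ρ₂ ρ₃ r h₂M h,
    lconv_gate_left M₁ M₃ ρ₁ _ r (gate_eq_zero_of_top M₃ ρ₃ r h₃M) h, lconv_gate_right M₁ M₃ ρ₁ ρ₃ r h₁M h,
    lconv_gate_left M₁ M₂ ρ₁ _ r (gate_eq_zero_of_top M₂ ρ₂ r h₂M) h, lconv_gate_right M₁ M₂ ρ₁ ρ₂ r h₁M h,
    gate_apply ρ₃ r h, gate_apply ρ₂ r h,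
    -- B
    gate_apply (lconv (M₁ + M₂) M₃ (lconv M₁ M₂ ρ₁ ρ₂) ρ₃) s h,
    -- C components
    lconv_gate_left M₁ (M₂ + M₃) ρ₁ _ s (gate_eq_zero_of_top (M₂ + M₃) _ s h₂₃M) h,
    lconv_gate_right M₁ (M₂ + M₃) ρ₁ (lconv M₂ M₃ ρ₂ ρ₃) s h₁M h,
    gate_apply (lconv M₂ M₃ ρ₂ ρ₃) s h, lconv_assoc M₁ M₂ M₃ ρ₁ ρ₂ ρ₃,
    lconv_gate_left M₂ (M₁ + M₃) ρ₂ _ s (gate_eq_zero_of_top (M₁ + M₃) _ s h₁₃M) h,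
    lconv_gate_right M₂ (M₁ + M₃) ρ₂ (lconv M₁ M₃ ρ₁ ρ₃) s h₂M h,
    gate_apply (lconv M₁ M₃ ρ₁ ρ₃) s h, lconv_lconv_swap M₁ M₂ M₃ ρ₁ ρ₂ ρ₃ h,
    lconv_gate_left (M₁ + M₂) M₃ (lconv M₁ M₂ ρ₁ ρ₂) _ s (gate_eq_zero_of_top M₃ ρ₃ s h₃M) h,
    lconv_gate_right (M₁ + M₂) M₃ (lconv M₁ M₂ ρ₁ ρ₂) ρ₃ s h₁₂M h, gate_apply ρ₃ s h]
  linear_combination (if h = 0 then (1 : ℝ) else 0) * hE0 + (ρ₁ h + ρ₂ h + ρ₃ h) * hE1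
    + (lconv M₂ M₃ ρ₂ ρ₃ h + lconv M₁ M₃ ρ₁ ρ₃ h + lconv M₁ M₂ ρ₁ ρ₂ h) * hE2
    + lconv (M₁ + M₂) M₃ (lconv M₁ M₂ ρ₁ ρ₂) ρ₃ h * hE3

end LawDec

end Quant

end Summit.CriticalPhenomena.PercolationContinuityZ3.Theorems
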